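import Summits.HodgeConjecture.CorCM.IrreducibleOddWeightsMultiplicityCMFields
import Summits.HodgeConjecture.CorCM.IrreducibleOddWeightsMultiplicityCriterion
import Literature.NumberTheory.ComplexMultiplication.AbelianCMFamilyRankCharacters
import HarnessLib

/-!
# The multiplicity formula on a GALOIS MODEL: `dim MT(∏_i A_i) = 1 + Σ_π (d_π/δ_π) · rank[π(u_1) | ⋯ | π(u_m)]` over the
# irreducible `ℚ`-representations `π` of the finite group `Gal(L/ℚ)`

COR-CM (cell `pub-hodgecm2`, binder seat `b16` gen 57, count-neutral claim MULTIPLICITY, file F10 — the census-ready form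
of F4–F9 `CorCM/IrreducibleOddWeightsMultiplicity*`; theorems only, no definition, no named fact, no `sorry`).  NEW as
stated, hence under `Summits/`.  HONEST FRAMING: `dim MT` of a product of CM abelian varieties "for NAMED configurations"
(kernel, unconditional) computed from matrices of irreducible representations of a FINITE Galois group, for INT-4 «what is
known»; `HC_CM` is neither used nor asserted.

REGULAR SLOTS.  When every slot is the group `G` acting on itself by left translation, the evaluation spaces are column
spaces: `Ev_i(π) = range π(u_i)`, `π(u_i) = Σ_g u_1(Ψ_i)(g) π(g)` (F5 `evalSpace_eq_range_of_regular`), so: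
* §1 (abstract, `G` finite acting on itself) `invariants_stabilizer_one_eq_top`,
  **`finrank_antiSpan_sigmaType_eq_sum_finrank_range`** (`dim U(Σ) = Σ_k d_k · (dim Σ_i range π_k(u_i) / δ_k)`),
  **`typeRank_eq_iff_forall_finrank_range_eq`** (ONE type `Ψ` which is a CM type for a central-on-`G` conjugation `ρ`:
  `rank(Ψ) = |G|/2 + 1 ⟺ rank π_k(u_Ψ) = rank(1 − π_k(ρ))` for every covering irreducible — Mai's criterion
  "`π(τ)` invertible for every odd irreducible `π`" over `ℚ`, since `1 − π(ρ) = 2` on odd and `0` on even `π`).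
* §2 (CM fields) THE GALOIS MODEL.  `L` a Galois CM field containing the `K_i` (`e_i : K_i → L`, `ι : L → ℂ`, `ρ` the
  complex conjugation of `L`), `G₀ = Gal(L/ℚ)` acting on itself, `Ψ_i = {g | ι ∘ g ∘ e_i ∈ Φ_i}` (the tree dictionary
  `cmFamilyRank_eq_typeRank_gal`: `rank(Φ) = rank_{G₀}(Σ_Ψ)`): `isCMTypeWith_gal_family` (`ρ` is central because `L` is
  CM), **`cmFamilyRank_eq_one_add_sum_finrank_range`** — for the irreducible `ℚ`-representations `(π_k, V_k)` of the
  finite group `G₀` (pairwise non-isomorphic, covering `ℚ^{G₀}`):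
  **`dim MT(∏_i A_i) = cmFamilyRank Φ = 1 + Σ_k d_k · (dim Σ_i range π_k(u_{Ψ_i}) / δ_k)`**,
  **`isNondegenerateFamily_iff_sum_finrank_range`** (`Hg(∏A_i) = ∏Hg(A_i)` of dimension `Σ dim A_i` iff that sum is
  `Σ_i [K_i:ℚ]/2`), **`one_add_sum_filter_le_cmFamilyRank_gal`** (Mai's Prop. 1: `dim MT ≥ 1 + Σ_{k : some π_k(u_i) ≠ 0} d_k`).

## References

* [Mai1989] L. Mai, *Lower bounds for the ranks of CM types*, J. Number Theory 32 (1989), §2 Prop. 1 (proof: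
  "`rank(K, S) = rank(reg(τ)) = Σ_π d_π rank(π(τ))`") and the invertibility criterion.
* [Kubota1965] T. Kubota, *On the field extension by complex multiplication*, Trans. AMS 118 (1965), §4 Lemma 2.
* [Shimura1998] G. Shimura, *Abelian Varieties with Complex Multiplication and Modular Functions*, §8.1, §18.2 Lemma.
* [Deligne1982HodgeCycles] P. Deligne, *Hodge cycles on abelian varieties*, LNM 900 (1982), I Ex. 3.7 (c).
-/

set_option autoImplicit false

noncomputable section

open scoped BigOperators

open NumberField

universe u u' v w

namespace Summit.HodgeConjecture.CorCM.IrrOdd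

open Literature.NumberTheory.ComplexMultiplication

variable {G : Type w} [Group G]

/-- The evaluation space `Ev[G, π, w] = {T w : T equivariant}` (local notation, no definition). -/
local notation3 (prettyPrint := false) "Ev[" G' ", " π ", " w "]" =>
  Submodule.span ℚ {v | ∃ T : (_ → ℚ) →ₗ[ℚ] _,
    (∀ (g : G') (f : _ → ℚ), T (fun x => f (g⁻¹ • x)) = π g (T f)) ∧ T w = v}

variable [Fintype G] [DecidableEq G] {V : Type*} [AddCommGroup V] [Module ℚ V]

/-! ### §1 Regular slots: evaluation spaces are column spaces -/

section Regular

omit [Fintype G] [DecidableEq G] in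
/-- For `G` acting on itself, `Stab(1) = 1` and every vector is invariant. [folklore] -/
theorem invariants_stabilizer_one_eq_top (π : Representation ℚ G V) :
    Representation.invariants (π.comp (MulAction.stabilizer G (1 : G)).subtype) = ⊤ := by
  rw [eq_top_iff]
  intro v _
  rw [Representation.mem_invariants]
  rintro ⟨h, hh⟩
  rw [MulAction.mem_stabilizer_iff, smul_eq_mul, mul_one] at hh
  subst hh
  change π 1 v = v
  rw [map_one, Module.End.one_apply]

omit [Fintype G] [DecidableEq G] in
/-- On a regular slot `Ev[G, π, w] = range π(w)`, `π(w) = Σ_g w(g) π(g)`, read through the map form of F5.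
[cite: Mai1989, §2 Prop. 1 (proof)] -/
theorem map_invariants_eq_range [Fintype G] (π : Representation ℚ G V) (w : G → ℚ) :
    (Representation.invariants (π.comp (MulAction.stabilizer G (1 : G)).subtype)).map (∑ g, w g • π (id g)) =
      LinearMap.range (∑ g, w g • π g) := by
  rw [invariants_stabilizer_one_eq_top, Submodule.map_top]
  rfl

variable {I : Type u} [Fintype I] {K : Type u'} [Fintype K] {W : K → Type*} [∀ k, AddCommGroup (W k)]
  [∀ k, Module ℚ (W k)] [∀ k, FiniteDimensional ℚ (W k)]

/-- **REGULAR SLOTS: `dim U(Σ) = Σ_k d_k · (dim Σ_i range π_k(u_i) / δ_k)`** for a family `Ψ_i ⊆ G` of types of a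
finite group acting on itself (`u_i = u_1(Ψ_i)`, `π_k(u_i) = Σ_g u_i(g) π_k(g)`), the irreducibles `π_k` being pairwise
non-isomorphic and covering `U(Σ)` — Mai's `rank = Σ_π d_π rank π(τ)` for FAMILIES, over `ℚ`.
[cite: Mai1989, §2 Prop. 1 (proof)] [cite: Kubota1965, §4 Lemma 2] -/
theorem finrank_antiSpan_sigmaType_eq_sum_finrank_range (Ψ : I → Set G) (π : ∀ k, Representation ℚ G (W k))
    (hirr : ∀ k, (π k).IsIrreducible) (hne : ∀ k l, k ≠ l → ∀ S : (π k).IntertwiningMap (π l), S = 0)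
    (hcov : ∀ P : Submodule ℚ ((Σ _ : I, G) → ℚ), P ≤ antiSpan G (sigmaType (E := fun _ : I => G) Ψ) → P ≠ ⊥ →
      (∀ (g : G) (f : (Σ _ : I, G) → ℚ), f ∈ P → (fun y => f (g • y)) ∈ P) →
      ∃ k, ∃ T : ((Σ _ : I, G) → ℚ) →ₗ[ℚ] W k,
        (∀ (g : G) (f : (Σ _ : I, G) → ℚ), T (fun y => f (g⁻¹ • y)) = π k g (T f)) ∧ ∃ f ∈ P, T f ≠ 0) :
    Module.finrank ℚ (antiSpan G (sigmaType (E := fun _ : I => G) Ψ)) = ∑ k, Module.finrank ℚ (W k) *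
      (Module.finrank ℚ (⨆ i, LinearMap.range (∑ g, antiVec (Ψ i) (1 : G) g • π k g) : Submodule ℚ (W k)) /
        Module.finrank ℚ ((π k).IntertwiningMap (π k))) := by
  have hs : ∀ (_ : I) (y : G), (id y) • (1 : G) = y := fun _ y => by rw [id, smul_eq_mul, mul_one]
  rw [finrank_antiSpan_sigmaType_eq_sum_finrank_map (E := fun _ : I => G) Ψ (fun _ => 1) (fun _ => id) hs π hirr
    hne hcov]
  refine Finset.sum_congr rfl fun k _ => ?_
  have h : (⨆ i, (Representation.invariants ((π k).comp (MulAction.stabilizer G (1 : G)).subtype)).map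
      (∑ y, antiVec (Ψ i) (1 : G) y • π k (id y)) : Submodule ℚ (W k)) =
      ⨆ i, LinearMap.range (∑ g, antiVec (Ψ i) (1 : G) g • π k g) :=
    iSup_congr fun i => map_invariants_eq_range (π k) _
  rw [h]

/-- **ONE TYPE ON A REGULAR CM SLOT: `rank(Ψ) = |G|/2 + 1 ⟺ rank π_k(u_Ψ) = rank(1 − π_k(ρ))` for every covering
irreducible `π_k`** (`ρ ∈ G` a conjugation for which `Ψ` is a CM type; irreducibles covering the odd weights) — Mai's
"nondegenerate ⟺ `π(τ)` invertible for every odd irreducible `π`" (there over `ℂ`; `1 − π(ρ)` is `2` on odd, `0` on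
even `π`). [cite: Mai1989, §2 Prop. 1] [cite: Kubota1965, §4 Lemma 2] -/
theorem typeRank_eq_iff_forall_finrank_range_eq {ρ : G} {Ψ : Set G} (h : IsCMTypeWith ρ Ψ)
    (π : ∀ k, Representation ℚ G (W k)) (hirr : ∀ k, (π k).IsIrreducible)
    (hne : ∀ k l, k ≠ l → ∀ S : (π k).IntertwiningMap (π l), S = 0)
    (hcov : ∀ P : Submodule ℚ (G → ℚ), P ≤ antiWeights (E := G) ρ → P ≠ ⊥ →
      (∀ (g : G) (f : G → ℚ), f ∈ P → (fun x => f (g • x)) ∈ P) →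
      ∃ k, ∃ T : (G → ℚ) →ₗ[ℚ] W k,
        (∀ (g : G) (f : G → ℚ), T (fun x => f (g⁻¹ • x)) = π k g (T f)) ∧ ∃ f ∈ P, T f ≠ 0) :
    typeRank G Ψ = Fintype.card G / 2 + 1 ↔
      ∀ k, Module.finrank ℚ (LinearMap.range (∑ g, antiVec Ψ (1 : G) g • π k g)) =
        Module.finrank ℚ (LinearMap.range (1 - π k ρ)) := by
  have hs : ∀ y : G, (id y) • (1 : G) = y := fun y => by rw [id, smul_eq_mul, mul_one]
  rw [typeRank_eq_iff_forall_finrank_map_eq h hs π hirr hne hcov]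
  refine forall_congr' fun k => ?_
  have hB : (Representation.invariants ((π k).comp (MulAction.stabilizer G (1 : G)).subtype)).map
      (∑ x, ((Pi.single (1 : G) (1 : ℚ) : G → ℚ) x - (Pi.single (ρ • (1 : G)) (1 : ℚ) : G → ℚ) x) • π k (id x)) =
      LinearMap.range (1 - π k ρ) := by
    rw [sum_sub_single_smul_eq (π k) ρ (1 : G) id, invariants_stabilizer_one_eq_top, Submodule.map_top, id, id,
      smul_eq_mul, mul_one, map_one]
  rw [map_invariants_eq_range, hB]

end Regular

end Summit.HodgeConjecture.CorCM.IrrOdd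

/-! ### §2 CM fields: the Galois model -/

namespace Summit.HodgeConjecture.CorCM

open Literature.NumberTheory.ComplexMultiplication
open Literature.AlgebraicGeometry.Motives (CMType)
open Literature.AlgebraicGeometry.Pohlmann1968

variable {I : Type} [Fintype I] {K : I → Type} [∀ i, Field (K i)] [∀ i, NumberField (K i)] [∀ i, IsCMField (K i)]
  {L : Type} [Field L] [NumberField L] [IsCMField L] [Normal ℚ L]
  {κ : Type u'} [Fintype κ] {V : κ → Type*} [∀ k, AddCommGroup (V k)] [∀ k, Module ℚ (V k)]
  [∀ k, FiniteDimensional ℚ (V k)]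

omit [Fintype I] [∀ i, NumberField (K i)] [∀ i, IsCMField (K i)] [Normal ℚ L] in
/-- **The members read on `G₀ = Gal(L/ℚ)` are CM types for the complex conjugation `ρ` of the CM field `L`** (acting on
`G₀` by left translation): `ι ∘ ρg ∘ e_i` is the conjugate of `ι ∘ g ∘ e_i`, and `ρ` is CENTRAL in `G₀` because `L` is CM
(`φ ∘ ρ_L = conj ∘ φ` for every embedding `φ`). [cite: Shimura1998, §18.2 Lemma (i)] -/
theorem isCMTypeWith_gal_family (ι : L →+* ℂ) (e : ∀ i, K i →+* L) (ρ : L ≃ₐ[ℚ] L)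
    (hρ : ∀ x, ι (ρ x) = starRingEnd ℂ (ι x)) (Φ : ∀ i, CMType (K i)) (i : I) :
    IsCMTypeWith ρ ({g : L ≃ₐ[ℚ] L | (ι.comp (g : L →+* L)).comp (e i) ∈ (Φ i).1} : Set (L ≃ₐ[ℚ] L)) := by
  -- `ρ` is the complex conjugation of `L`, hence an involution, central in `Gal(L/ℚ)`
  have hρc : ∀ x, ρ x = IsCMField.complexConj L x := fun x =>
    ι.injective (by rw [hρ, IsCMField.complexEmbedding_complexConj])
  have hρρ : ρ * ρ = 1 := AlgEquiv.ext fun x => ι.injective (by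
    rw [AlgEquiv.mul_apply, hρ, hρ, starRingEnd_self_apply, AlgEquiv.one_apply])
  have hcomm : ∀ g : L ≃ₐ[ℚ] L, g * ρ = ρ * g := fun g => by
    refine AlgEquiv.ext fun x => ι.injective ?_
    rw [AlgEquiv.mul_apply, AlgEquiv.mul_apply, hρ, hρc]
    exact IsCMField.complexEmbedding_complexConj L (ι.comp (g : L →+* L)) x
  refine ⟨fun g => ?_, fun g g' => ?_, fun g => ?_⟩
  · show (ι.comp (g : L →+* L)).comp (e i) ∈ (Φ i).1 ↔
      ¬(ι.comp ((ρ * g : L ≃ₐ[ℚ] L) : L →+* L)).comp (e i) ∈ (Φ i).1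
    have hconj : (ι.comp ((ρ * g : L ≃ₐ[ℚ] L) : L →+* L)).comp (e i) =
        ComplexEmbedding.conjugate ((ι.comp (g : L →+* L)).comp (e i)) := by
      refine RingHom.ext fun x => ?_
      rw [ComplexEmbedding.conjugate_coe_eq]
      change ι ((ρ * g) (e i x)) = starRingEnd ℂ (ι (g (e i x)))
      rw [AlgEquiv.mul_apply, hρ]
    rw [hconj]
    exact (Φ i).2 _
  · show g * (ρ * g') = ρ * (g * g')
    rw [← mul_assoc, hcomm g, mul_assoc]
  · show ρ * (ρ * g) = g
    rw [← mul_assoc, hρρ, one_mul]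

omit [∀ i, IsCMField (K i)] in
/-- **THE GALOIS MODEL FORMULA: `dim MT(∏_i A_i) = cmFamilyRank Φ = 1 + Σ_k d_k · (dim Σ_i range π_k(u_{Ψ_i}) / δ_k)`**
over the irreducible `ℚ`-representations `(π_k, V_k)` of the finite group `Gal(L/ℚ)` (pairwise non-isomorphic, covering
`ℚ^{Gal(L/ℚ)}`), where `Ψ_i = {g | ι ∘ g ∘ e_i ∈ Φ_i}`, `π_k(u) = Σ_g u(g) π_k(g)`, `u_{Ψ_i} = 𝟙_{Ψ_i} − 𝟙_{ρΨ_i}`,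
`d_k = dim V_k`, `δ_k = dim End V_k` — any CM fields `K_i ⊆ L`, any types.
[cite: Mai1989, §2 Prop. 1 (proof)] [cite: Kubota1965, §4 Lemma 2] [cite: Deligne1982HodgeCycles, I Ex. 3.7 (c)] -/
theorem cmFamilyRank_eq_one_add_sum_finrank_range [Nonempty I] (ι : L →+* ℂ) (e : ∀ i, K i →+* L) (ρ : L ≃ₐ[ℚ] L)
    (hρ : ∀ x, ι (ρ x) = starRingEnd ℂ (ι x)) (Φ : ∀ i, CMType (K i))
    (π : ∀ k, Representation ℚ (L ≃ₐ[ℚ] L) (V k)) (hirr : ∀ k, (π k).IsIrreducible)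
    (hne : ∀ k l, k ≠ l → ∀ S : (π k).IntertwiningMap (π l), S = 0)
    (hcov : ∀ P : Submodule ℚ ((L ≃ₐ[ℚ] L) → ℚ), P ≠ ⊥ →
      (∀ (g : L ≃ₐ[ℚ] L) (f : (L ≃ₐ[ℚ] L) → ℚ), f ∈ P → (fun x => f (g • x)) ∈ P) →
      ∃ k, ∃ T : ((L ≃ₐ[ℚ] L) → ℚ) →ₗ[ℚ] V k,
        (∀ (g : L ≃ₐ[ℚ] L) (f : (L ≃ₐ[ℚ] L) → ℚ), T (fun x => f (g⁻¹ • x)) = π k g (T f)) ∧ ∃ f ∈ P, T f ≠ 0) :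
    CMAlgebra.cmFamilyRank Φ = 1 + ∑ k, Module.finrank ℚ (V k) *
      (Module.finrank ℚ (⨆ i, LinearMap.range (∑ g : L ≃ₐ[ℚ] L,
          antiVec ({g : L ≃ₐ[ℚ] L | (ι.comp (g : L →+* L)).comp (e i) ∈ (Φ i).1} : Set (L ≃ₐ[ℚ] L))
            (1 : L ≃ₐ[ℚ] L) g • π k g) : Submodule ℚ (V k)) /
        Module.finrank ℚ ((π k).IntertwiningMap (π k))) := by
  classical
  obtain ⟨i₀⟩ := ‹Nonempty I›
  haveI : Nonempty (Σ _ : I, (L ≃ₐ[ℚ] L)) := ⟨⟨i₀, 1⟩⟩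
  have hΨ := isCMTypeWith_gal_family ι e ρ hρ Φ
  rw [cmFamilyRank_eq_typeRank_gal ι e Φ, (IsCMTypeWith.sigmaType hΨ).typeRank_eq_finrank_antiSpan_add_one,
    IrrOdd.finrank_antiSpan_sigmaType_eq_sum_finrank_range
      (fun i => ({g : L ≃ₐ[ℚ] L | (ι.comp (g : L →+* L)).comp (e i) ∈ (Φ i).1} : Set (L ≃ₐ[ℚ] L))) π hirr hne
      (IrrOdd.cover_sigmaType_of_forall _ π fun i P _ hP0 hPst => hcov P hP0 hPst), add_comm]

omit [∀ i, IsCMField (K i)] in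
/-- **Nondegeneracy on the Galois model**: `Hg(∏_i A_i) = ∏_i Hg(A_i)` has dimension `Σ_i dim A_i` iff
`Σ_k d_k · (dim Σ_i range π_k(u_{Ψ_i}) / δ_k) = Σ_i [K_i:ℚ] / 2`. [cite: Mai1989, §2 Prop. 1] [cite: Gordon1999HodgeAVSurvey, 7.5–7.7] -/
theorem isNondegenerateFamily_iff_sum_finrank_range [Nonempty I] (ι : L →+* ℂ) (e : ∀ i, K i →+* L)
    (ρ : L ≃ₐ[ℚ] L) (hρ : ∀ x, ι (ρ x) = starRingEnd ℂ (ι x)) (Φ : ∀ i, CMType (K i))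
    (π : ∀ k, Representation ℚ (L ≃ₐ[ℚ] L) (V k)) (hirr : ∀ k, (π k).IsIrreducible)
    (hne : ∀ k l, k ≠ l → ∀ S : (π k).IntertwiningMap (π l), S = 0)
    (hcov : ∀ P : Submodule ℚ ((L ≃ₐ[ℚ] L) → ℚ), P ≠ ⊥ →
      (∀ (g : L ≃ₐ[ℚ] L) (f : (L ≃ₐ[ℚ] L) → ℚ), f ∈ P → (fun x => f (g • x)) ∈ P) →
      ∃ k, ∃ T : ((L ≃ₐ[ℚ] L) → ℚ) →ₗ[ℚ] V k,
        (∀ (g : L ≃ₐ[ℚ] L) (f : (L ≃ₐ[ℚ] L) → ℚ), T (fun x => f (g⁻¹ • x)) = π k g (T f)) ∧ ∃ f ∈ P, T f ≠ 0) :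
    CMAlgebra.IsNondegenerateFamily Φ ↔ ∑ k, Module.finrank ℚ (V k) *
      (Module.finrank ℚ (⨆ i, LinearMap.range (∑ g : L ≃ₐ[ℚ] L,
          antiVec ({g : L ≃ₐ[ℚ] L | (ι.comp (g : L →+* L)).comp (e i) ∈ (Φ i).1} : Set (L ≃ₐ[ℚ] L))
            (1 : L ≃ₐ[ℚ] L) g • π k g) : Submodule ℚ (V k)) /
        Module.finrank ℚ ((π k).IntertwiningMap (π k))) = (∑ i, Module.finrank ℚ (K i)) / 2 := by
  rw [CMAlgebra.isNondegenerateFamily_iff, cmFamilyRank_eq_one_add_sum_finrank_range ι e ρ hρ Φ π hirr hne hcov]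
  omega

omit [∀ i, IsCMField (K i)] in
open scoped Classical in
/-- **MAI'S PROP. 1 ON THE GALOIS MODEL**: `dim MT(∏_i A_i) ≥ 1 + Σ_{k : some π_k(u_{Ψ_i}) ≠ 0} d_k`.
[cite: Mai1989, §2 Prop. 1] [cite: Gordon1999HodgeAVSurvey, 9.4.4] -/
theorem one_add_sum_filter_le_cmFamilyRank_gal [Nonempty I] (ι : L →+* ℂ) (e : ∀ i, K i →+* L)
    (ρ : L ≃ₐ[ℚ] L) (hρ : ∀ x, ι (ρ x) = starRingEnd ℂ (ι x)) (Φ : ∀ i, CMType (K i))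
    (π : ∀ k, Representation ℚ (L ≃ₐ[ℚ] L) (V k)) (hirr : ∀ k, (π k).IsIrreducible)
    (hne : ∀ k l, k ≠ l → ∀ S : (π k).IntertwiningMap (π l), S = 0)
    (hcov : ∀ P : Submodule ℚ ((L ≃ₐ[ℚ] L) → ℚ), P ≠ ⊥ →
      (∀ (g : L ≃ₐ[ℚ] L) (f : (L ≃ₐ[ℚ] L) → ℚ), f ∈ P → (fun x => f (g • x)) ∈ P) →
      ∃ k, ∃ T : ((L ≃ₐ[ℚ] L) → ℚ) →ₗ[ℚ] V k,
        (∀ (g : L ≃ₐ[ℚ] L) (f : (L ≃ₐ[ℚ] L) → ℚ), T (fun x => f (g⁻¹ • x)) = π k g (T f)) ∧ ∃ f ∈ P, T f ≠ 0) :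
    1 + ∑ k ∈ Finset.univ.filter (fun k => ∃ i, (∑ g : L ≃ₐ[ℚ] L,
        antiVec ({g : L ≃ₐ[ℚ] L | (ι.comp (g : L →+* L)).comp (e i) ∈ (Φ i).1} : Set (L ≃ₐ[ℚ] L))
          (1 : L ≃ₐ[ℚ] L) g • π k g) ≠ 0), Module.finrank ℚ (V k) ≤ CMAlgebra.cmFamilyRank Φ := by
  classical
  obtain ⟨i₀⟩ := ‹Nonempty I›
  haveI : Nonempty (Σ _ : I, (L ≃ₐ[ℚ] L)) := ⟨⟨i₀, 1⟩⟩
  have hΨ := isCMTypeWith_gal_family ι e ρ hρ Φ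
  rw [cmFamilyRank_eq_typeRank_gal ι e Φ, (IsCMTypeWith.sigmaType hΨ).typeRank_eq_finrank_antiSpan_add_one, add_comm]
  refine Nat.add_le_add_right (le_trans (le_of_eq (Finset.sum_congr (Finset.filter_congr fun k _ => ?_) fun _ _ => rfl))
    (IrrOdd.sum_filter_finrank_le_finrank_antiSpan_sigmaType (E := fun _ : I => (L ≃ₐ[ℚ] L))
      (fun i => ({g : L ≃ₐ[ℚ] L | (ι.comp (g : L →+* L)).comp (e i) ∈ (Φ i).1} : Set (L ≃ₐ[ℚ] L))) π hirr hne
      (IrrOdd.cover_sigmaType_of_forall _ π fun i P _ hP0 hPst => hcov P hP0 hPst))) 1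
  refine exists_congr fun i => ?_
  rw [IrrOdd.evalSpace_eq_range_of_regular (π k), ne_eq, ne_eq, LinearMap.range_eq_bot]

end Summit.HodgeConjecture.CorCM

end
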